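import Mathlib
import HarnessLib
import HarnessLib.Audit
import Summits.RiemannHypothesis.Statement
import Summits.RiemannHypothesis.RiemannHypothesis.Theorems.LiDirichletAsymptoticDefs
import Summits.RiemannHypothesis.RiemannHypothesis.Theorems.LiEchoDirichletDefs
import Summits.RiemannHypothesis.RiemannHypothesis.Theorems.LiAsymptoticDefs
import Literature.NumberTheory.LFunctions.DirichletLZeroCountExplicit
import Literature.NumberTheory.LFunctions.DirichletLRiemannHypothesisUpTo
import Literature.NumberTheory.LFunctions.DirichletArgSBound
import Literature.NumberTheory.LFunctions.LiCriterionDirichlet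
import HarnessLib.Audit.Status.Attr

/-!
Route: LiDirichletAsymptotic

CLOSED (proved) 2026-08-26T14:15:24Z by operator:999:1494936 — reason: proved:Summit.RiemannHypothesis.RiemannHypothesis.Theorems.LiTheory.liDirichletAsymptoticLaw_proof. The file is kept as the record of this route; refuted decls are indexed as negative knowledge (`ledger negatives`).

# Route LiDirichletAsymptotic — RH-free Dirichlet Li asymptotic law — |Re λ_χ(n) − (n/2)log n − C₁n
− (n/2)log q| ≤ C√n log(qn) for n ≤ T²/4 from GRH(χ) verified to T, uniformly in q

Column LI of the RH ladder (D-0040/D-0059/D-0061), round 5, candidate (iii) = row L-D «Dirichlet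
twist» of the rung
L-P(P1⁺): the route closes the RUNG LEAF «DIRICHLET Li ASYMPTOTIC LAW»
`LiTheory.LiDirichletAsymptoticLaw` (RH-FREE,
GRH-FREE, PROOF-OF-DATA, height-USING not height-buying): for every primitive χ mod q > 1, every T ≥
1000 with
`LFunctionRHUpTo χ T` (all zeros of L(s,χ) with |Im ρ| ≤ T on the line — Platt 2016 to 10⁸/q for q ≤
4·10⁵) and every
n ≤ T²/4: `|liCoeffCharRe χ n − (liMainTerm n + (n/2) log q)| ≤ 15 √n log(qn)` for n ≥ 10⁴ (tree
constants) and
`≤ √n log(qn)` for n ≥ 900 given Bennett–Martin–O'Bryant–Rechnitzer's Theorem 1.1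
(`bmor2021_theorem11`, named fact),
where `liCoeffCharRe χ n = Σ'_ρ m_ρ Re[1 − (1 − 1/ρ)ⁿ]` is Bombieri–Lagarias' real Li coefficient
(absolutely convergent,
the T → ∞ limit of the box partial sums `charLiPartialRe χ n T`, RH-free:
`LiDirichlet.tendsto_re_liPartialSum`).  It
suffices to show X = LiBoxTwoSidedChar ∧ LiSmoothMainTermChar ∧ LiOscillatoryChar ∧ LiBudgetChar (+
the two RH-free
supports LiLowZerosChar, LiFarTailsChar): split the box partial sum at T' ≥ max(T, n²) as [Li sum −
weight trace](T')
+ [weight trace(T') − weight trace(√n)] + weight trace(√n); the first bracket is the far two-sided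
comparison (K1χ)
summed by the tails (S2χ) = ± charErrFar; the second is the smooth integral (K2χ: = charLiMainTerm −
M_exact(√n) ±
charErrSmooth) ± charErrOsc (K3χ); the third is M_exact(√n) ± charErrLow (S1χ); the EXACT boundary
main term
`charCountMainExact χ √n` CANCELS; K4χ bounds the four errors by C√n log(qn); let T' → ∞
(`le_of_tendsto`).
Lean: `Summit.RiemannHypothesis.RiemannHypothesis.Theorems.LiTheory.LiDirichletAsymptoticLaw`

## Assembly
Telescoping at T' ≥ max(T, n²): `charLiPartialRe χ n T' = [charLiPartialRe − charWeightTrace](T') +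
[charWeightTrace(T')
− charWeightTrace(√n)] + charWeightTrace(√n)`; K1χ + S2χ bound the first bracket by charErrFar q n T
(T ≥ 1000, n ≤ T²/4,
monotonicity of log T/T^k); K3χ + K2χ turn the second into charLiMainTerm q n − charCountMainExact χ
√n ± (charErrOsc +
charErrSmooth); S1χ gives charWeightTrace(√n) = charCountMainExact χ √n ± charErrLow; the exact
boundary term cancels;
K4χ closes the budget; `le_of_tendsto` with `LiDirichlet.tendsto_re_liPartialSum` (RH-free) passes
to liCoeffCharRe.
The composition is the ζ Assembly (19166, CLOSED, Theorems/LiAsymptoticAssembly.lean) with the χ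
names.

CLOSES_TARGET: closes rung L-P(P1+chi) of RiemannHypothesis: Summit.RiemannHypothesis.RiemannHypothesis.Theorems.LiTheory.LiDirichletAsymptoticLaw (D-0061; not the summit Statement) — the deciding theorem of this route concludes that registered leaf instead of the Statement decl `RiemannHypothesis` (class rung: servable and labelled, never counted as concluding the summit Statement).

Rationale: WHY THIS LINE. The rung L-P(P1⁺) for ζ (route LiAsymptotic) is CLOSED item by item (19162–19166,
19229/19230; 2026-08-26): the tree
now proves |λ_n − (n/2)log n − C₁n| ≤ 2√n log n on 900 ≤ n ≤ T²/4 from RH verified to T.  Row L-D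
asks what in that
law is ζ-specific; the χ-transfer answers «nothing but the density»: the conductor shifts the main
term by (n/2)log q
(the model integral against log(qt/2π)), the parity enters only below the error (ψ((½+a+it)/2) vs
log), and the
oscillatory control is the two-sided counting remainder of L(s,χ) — crude but PROVED in the tree (MV
Cor. 14.7 with
Backlund–Jensen constants, `DirichletTheta.abs_lfunctionZeroCount_sub_le`) and sharp in print
(Bennett–Martin–
O'Bryant–Rechnitzer 2021 Thm 1.1 [BennettMartinOBryantRechnitzer2021], typed as
`bmor2021_theorem11`).  The verified
input exists at scale: Platt 2016 [Platt2016GRH] (`platt2016_theorem71`: GRH for every primitive χ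
mod q ≤ 400 000 to
height ≥ 10⁸/q).  In print the shape is known only asymptotically and under GRH (Li 2004; Lagarias
2007
[Lagarias2007LiCoefficients] §1 for automorphic L-functions: λ_n(π) = (n/2) log n + c(π) n + O(√n
log n) under GRH;
Omar–Bouanani / Mazhouda for the Selberg class); an explicit finite-height version uniform in q is
not in print.  The
cell's data (eng-5 ET-R5, 38 L-functions, n ≤ 10³, q ≤ 13): sup |Re λ_χ(n) − trend|/(√n log(qn)) =
0.184 — the law
holds with two orders of room; its constants are proof-driven (the S(t,χ) slope), which is the point
of a PROOF-OF-DATA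
rung.  Imported from another area: nothing; classical explicit zero-counting plus a verified height.

RANKED CRUXES. #2 LiOscillatoryChar (crux) — (K3χ, deciding) OSCILLATORY CONTROL, RH-free: the
window sum `Σ_{√n<|γ|≤T'} m f_n(|γ|)` minus its smooth part `(2/π)∫_{√n}^{T'} f_n g_χ` is at most
`charErrOscP q n` (tree constants, n ≥ 10⁴) resp., given BMOR Thm 1.1, `charErrOscB q n` (n ≥ 900),
plus the TOP boundary term `(n²/(2T'²))·rem(q,T')` which vanishes as T' → ∞ (q-uniformity forces it
out of the constant): window identity against the two-sided count N(t,χ) = exact main + remainder,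
ONE integration by parts (|f_n'| ≤ n/t², f_n ≤ 2, f_n(t) ≤ n²/(2t²)). [difficulty: L] (why it might
fail: the remainder bound holds only off ordinates (`abs_lfunctionZeroCount_sub_le`) inside a
Stieltjes IBP over a step function (one-sided limits); the constants 46.8 / 0.42 bounding
∫(n/t²)·rem are certified only through K4χ's budget, not term by term; log(1+ℓ(T')) unbounded ⇒
explicit top term.) [MontgomeryVaughan2007, BennettMartinOBryantRechnitzer2021,
Lagarias2007LiCoefficients, tree:Literature/NumberTheory/LFunctions/DirichletArgSBound.lean,
tree:Literature/NumberTheory/LFunctions/DirichletLZeroCountExplicit.lean]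
#3 LiBoxTwoSidedChar (crux) — (K1χ) TWO-SIDED BOX COMPARISON: below the verified height every zero
is on the line and contributes `m f_n(|γ|)` EXACTLY to `Re Σ m[1 − (1 − 1/ρ)ⁿ]`; above it the zeros
pair as `{ρ, 1 − ρ̄}` (functional equation + reflection, same multiplicity) and the pair is compared
with `2 f_n(γ)` two-sidedly: `2(cosh(n log r) − 1) + 2n|φ − θ(γ)|` per pair, giving the per-zero
constants `2.82 n²/γ⁴` and `(n/2)/|γ|³` of the ζ twin LiBoxTwoSided (19163, CLOSED) with a factor 2
to spare. [difficulty: M] (why it might fail: the χ-pair {ρ, 1−ρ̄} shares the ordinate, so the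
comparison angle lemma is the ζ one, but the multiplicity identity zeroOrder χ (1 − conj ρ) =
zeroOrder χ ρ must come from the tree's reflection for dirichletXi (odd χ: normalisation
q^{(s+a)/2}); n ≤ T²/4 is where (1 − 1/ρ)ⁿ stays bounded for |γ| …) [Lagarias2007LiCoefficients,
BombieriLagarias1999, MontgomeryVaughan2007,
tree:Literature/NumberTheory/LFunctions/DirichletLFunctionZeroReflection.lean,
tree:Literature/NumberTheory/LFunctions/ExplicitFormulaPsiCharZeros.lean (zeroOrder_one_sub_eq_inv),
tree:Literature/NumberTheory/LFunctions/DirichletXiConjugation.lean,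
tree:Summits/RiemannHypothesis/RiemannHypothesis/Theorems/LiAsymptoticLiBoxTwoSided.lean]
#4 LiSmoothMainTermChar (crux) — (K2χ) SMOOTH MAIN TERM: `(2/π)∫_{√n}^{T'} f_n(t) g_χ(t) dt =
charLiMainTerm q n − charCountMainExact χ √n ± charErrSmooth q n` (= 2 log n + 2 log q + 3) for T' ≥
n², n ≥ 100 — the ζ computation (19162, CLOSED: exact model identity
(2/π)∫₀^∞(1−cos(n/t))·½log(t/2π) = liMainTerm n, corrections θ vs 1/t and the two cuts) with ϑ'
replaced by g_χ = ½Re ψ((½+a+it)/2) + ½log(q/π): the conductor adds (log q/π)∫f_n = (n/2)log q −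
(√n/π)log q + O(log q), the √n-term being the q-part of the EXACT boundary main term
charCountMainExact (whose derivative is (2/π)g_χ), and |½Re ψ − ½ log(t/2)| ≤ 1/t² (tree
DigammaGauss.abs_re_digamma_sub_log_norm_le) costs O(1/√n). [difficulty: M] (why it might fail:
charErrSmooth's «2 log q + 3» is derived but generous; the exact boundary term needs d/dt
charCountMainExact = (2/π)·charGammaDensity as an FTC statement for gammaArgPhase (the Γ_ℝ(s+κ) ↔
ψ((½+a+it)/2) half-scaling is a factor-2 trap), plus |½Re ψ − ½log(t/2)| ≤ 1/t² from DigammaGauss.)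
[Lagarias2007LiCoefficients, MontgomeryVaughan2007,
tree:Literature/Analysis/SpecialFunctions/DigammaGauss.lean,
tree:Summits/RiemannHypothesis/RiemannHypothesis/Theorems/LiAsymptoticLiSmoothMainTerm.lean,
tree:Literature/NumberTheory/LFunctions/DirichletLZeroCountingParityProfile.lean]
#5 LiBudgetChar (crux) — (K4χ) ERROR BUDGET: a closed-form real inequality in (q, n, T), uniform in
q ≥ 2: far + low + smooth + oscillatory ≤ 15 √n log(qn) (n ≥ 10⁴, tree constants) resp. ≤ √n log(qn)
(n ≥ 900, BMOR constants); in-seat float sup of budget/bound = 0.908 (q → ∞ limit 12.975/15) resp.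
0.827 (at q = 3000, n = 900, T = 1000). [difficulty: S] (why it might fail: three-variable
inequality (q,n,T); interval-certified in-seat (et_r5b_interval.py: plain ≤ 0.929, BMOR ≤ 0.864 on n
≤ 10⁴⁰, exact affine-in-log q sup; tail by a termwise majorant the Lean proof must re-derive) — a
Lean proof over three variables is still real work; plain margin → 0.886.)
[folder:r5_budget_check.py, Lagarias2007LiCoefficients, BennettMartinOBryantRechnitzer2021]
#9 LiFarTailsChar (support) — [support] (S2χ) RH-FREE FAR TAILS: `Σ_{T<|γ|≤U} m/|γ|³ ≤
log(qT)/(πT²)` and `Σ m/γ⁴ ≤ log(qT)/(2πT³)` for T ≥ 1000, by Stieltjes integration of t^{−k}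
against the two-sided count (main (1/(2πT²))(log(qT/2πe) + 3/2), resp. (1/(3πT³))(log(qT/2πe) +
4/3), plus 2·argSRem/T^k) — the χ twin of LiFarZeroTailCube (19229, CLOSED). [difficulty: M]
[MontgomeryVaughan2007,
tree:Summits/RiemannHypothesis/RiemannHypothesis/Theorems/LiAsymptoticLiFarZeroTailCube.lean]
#9 LiLowZerosChar (support) — [support] (S1χ) LOW ZEROS TRIVIALLY (RH-free): `0 ≤ Σ_{|γ|≤√n} m f_n ≤
2N(√n,χ)` and the two-sided count give `|Σ − M_exact(√n)| ≤ M_exact(√n) + 2·rem(√n)`, with the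
one-sided Stirling step `charCountMainExact χ a ≤ charCountMain q a + 1` (θ_κ(a) ≤ (a/2)log(a/2πe) +
½, classical). [difficulty: M] [MontgomeryVaughan2007,
tree:Literature/NumberTheory/LFunctions/DirichletArgSBound.lean,
tree:Literature/NumberTheory/LFunctions/DirichletLZeroCountingParityProfile.lean]

TWO-LAYER PLAN. Each crux is the χ-twin of a CLOSED ζ item whose Theorems file is the template: K1χ
⇐ LiAsymptoticLiBoxTwoSided (pair
instead of quadruple), K2χ ⇐ LiAsymptoticLiSmoothMainTerm (+ the log q channel and the digamma–log
comparison
`DigammaGauss.abs_re_digamma_sub_log_norm_le`), K3χ ⇐ LiAsymptoticOscPlain (counting remainder of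
L(s,χ): tree
`abs_lfunctionZeroCount_sub_le` / named fact `bmor2021_theorem11`), K4χ ⇐ LiAsymptoticBudget
(norm_num/interval
bookkeeping), S1χ/S2χ ⇐ LiAsymptoticLowZeros / LiAsymptoticFarZeroTails, Assembly ⇐
LiAsymptoticAssembly.  Foreseen
glued split only for K3χ: stub_window_identity_char (Stieltjes IBP for the finsum against
lfunctionZeroCount) →
stub_remainder_integral_char (∫ n/t²·rem ≤ budget).

KILL CRITERIA. (i) K4χ dies AS TYPED if an interval pass finds sup budget/(C√n log(qn)) > 1 on the
stated ranges (repair: C or n₀;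
not fatal).  (ii) K1χ dies as typed if the reflection multiplicity identity for dirichletXi fails
for odd χ with the
tree's normalisation (repair by restatement).  (iii) The LEAF dies only if certified zero data
contradict it — e.g.
eng's ET-R5 table extended with certified zeros to T' = n² for one χ and one n ≥ 900 showing |Re
λ_χ(n) − charLiMainTerm|
> √n log(qn) (data sit at ≤ 0.184 of the bound: practically excluded).  Proved elsewhere that moots
it: an explicit
finite-height Li law for Dirichlet L in print (none found).

NOT DECOMPOSED YET. BC6 cone = four cruxes + two supports + Assembly.  Later rungs, not this route:
the Turing-sharpened form (a Turing
∫S(t,χ) bound is not in the tree), the q-averaged law over χ mod q, the PART F reading «Re S_χ(n) =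
O(√n log(qn))»
against the arithmetic trend (support `|charLiTrendMain χ n − charLiMainTerm q n| ≤ 1`, harmonic
numbers), and the
discharge of `bmor2021_theorem11` (XL).

CHEAPEST FALSIFIER. RUN (in seat, float, r5_budget_check.py): sup over q ∈ [2, 10³⁰], n ∈ [n₀,
10⁴⁵], T ∈ {max(1000, 2√n), 3×, 10⁸} of
budget/(C√n log(qn)) = 0.908 (plain, C = 15, n₀ = 10⁴) and 0.827 (BMOR, C = 1, n₀ = 900) — PASS with
margin; an INTERVAL
pass (ET-R5b, eng, < 1 core-h) is the cheapest formal falsifier of K4χ.  DATA: ET-R5 (eng-5): 38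
L-functions, q ≤ 13,
n ≤ 10³: |Re λ_χ(n) − charLiTrendMain χ n| ≤ 0.184 √n log(qn) for all n ≥ 2 (0.0617 for n ≥ 200) —
consistent.  FORMAL and
cheap: the odd-character reflection identity behind K1χ (ten lines from
DirichletLFunctionZeroReflection).

NUMBERS. C₁ = liC1 = (γ − 1 − log 2π)/2 = −1.1303; main-term shift (n/2) log q; counting remainders:
tree argSRem q t = 5 +
12.975 log(9.1902 q (t+4)) (2/log(7/6) = 12.975, 2ζ(5/4) = 9.1902) vs BMOR bmorRem q t = 0.22737 ℓ +
2 log(1+ℓ) − 0.25,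
ℓ = log(q(t+2)/2π); hence C = 15 vs C = 1.  Platt corollary: q ≤ 10⁵, T = 10⁸/q, 900 ≤ n ≤
2.5·10¹⁵/q².  Data (ET-R5):
C(χ) = 0.184 / 0.0914 (n ≥ 50) / 0.0617 (n ≥ 200); ⟨|lt|²⟩/√n ≈ 0.263 + 0.159 log q (eng S3).

DEFINITION REQUESTS. None beyond PART H = HOME/theory/route/r5/LiDirichletAsymptoticDefs.lean (farm
rc 0, 0 sorries): charLiMainTerm,
charCountMain, charCountMainExact, charWeightTrace, charLiPartialRe, charInvMomentTail, bmorRem,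
argSRem, charErrFar,
charErrSmooth, charErrOscB/P, charErrLowB/P, the leaf LiDirichletAsymptoticLaw and the corollary
LiDirichletAsymptoticPlatt
— to be landed by eng as
`Summits/RiemannHypothesis/RiemannHypothesis/Theorems/LiDirichletAsymptoticDefs.lean` and the
leaf registered as an alternative closer (rung id by 21-frontier) before `route open`.

Novelty: LENS = transfer (ζ → χ, the solved sibling = route LiAsymptotic, CLOSED item by item 2026-08-26).
DICTIONARY, step for step (ζ item ↦ χ item; what changes):
(1) 19163 LiBoxTwoSided ↦ K1χ LiBoxTwoSidedChar — zero set `riemannZeta` multiset on [0,T'] ↦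
`lfunctionZeroBox χ T'` with `DirichletDisc.zeroOrder`; quadruples {ρ, ρ̄, 1−ρ, 1−ρ̄} ↦ PAIRS {ρ,
1−ρ̄} (χ̄ ≠ χ: no up/down symmetry), two-sided box instead of upper box; the angle lemma and `cosh y
− 1 ≤ 0.6504 y²` transfer verbatim (`liBoxTwoSided_proof`).
(2) 19162 LiSmoothMainTerm ↦ K2χ — density ½ log(t/2π) ↦ g_χ(t) = ½ Re ψ(¼ + κ/2 + it/2) + ½
log(q/π) (`charGammaDensity`); NEW conductor channel (log q/π)∫f_n = (n/2) log q − (√n/π) log q +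
O(log q) giving the shifted main term `charLiMainTerm q n = liMainTerm n + (n/2) log q`;
digamma-vs-log by the tree's `DigammaGauss`/`DigammaLogBound`; PART C's model integral
(`LiAsymptoticModelIntegral/Laplace/Fubini`) reused by name.
(3) 19164 LiOscillatoryS ↦ K3χ LiOscillatoryChar = the FIRST NON-TRANSFERRING STEP (deciding crux):
ζ's remainder |N − M| ≤ 0.28 log T (Trudgian/PT, q-free) ↦ the two-sided remainder of N(t,χ) whose
slope carries log q: tree `abs_lfunctionZeroCount_sub_le` (12.975 log(q(t+4)) + 47) resp. BMOR Thm
1.1 (0.22737 ℓ + 2 log(1+ℓ)); the integration by parts must be RE-DERIVED with q inside every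
constant and the TOP boundary term kept explicit ((n²/(2T'²))·rem(q,T'), vanishing) — q-uniformity
is exactly what does not transfer for free.
(4) 19165 LiAsymptoticBudge  [refs: book:montgomery2007-multiplicative-number-theory-i-classical-theory, book:inam2019-notes-from-international-autumn-school-computational-number, book:montgomery2007-, paper:arxiv-math_0404394, paper:doi-10-1112-s1461157010000215, Li2004]

Barriers (technique_class: explicit-window, zero-counting, dirichlet-twist): - technique_class: explicit-window, zero-counting, dirichlet-twist
- Literature.Barriers.RiemannHypothesis.BoundedFluctuationCounting: outside — the barrier (Selberg
1946: S(T) = Ω±, `BoundedFluctuationCounting_holds`) forbids COUNTING laws with bounded fluctuation;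
here S(t,χ) enters only through a PROVED two-sided remainder O(log qt) integrated against f_n' and
the law's error C√n log(qn) dominates it by √n
[corpus:book:montgomery2007-multiplicative-number-theory-i-classical-theory p.414 (Cor. 14.7-type
counting for L(s,χ)); no hits for "Li coefficients" × "S(T)" for characters in corpus(fts+vec) and
galaxy pdf].
- Literature.Barriers.RiemannHypothesis.ExceptionalZero: outside — the barrier concerns PROVING
zero-free regions for real χ (Landau–Siegel); this route proves nothing about L(s,χ) ≠ 0: a verified
height `LFunctionRHUpTo χ T` is an INPUT (Platt 2016 [Platt2016GRH] Thm 7.1 supplies it for q ≤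
4·10⁵, where no exceptional zero exists), a real zero β ≠ ½ would have |Im| = 0 ≤ T and falsify the
hypothesis (statement vacuous for that χ, still true), and every constant is uniform in q with no
appeal to Siegel-type ineffective bounds.
- Literature.Barriers.RiemannHypothesis.LindelofBacklund / GramRosserFailures: outside — no size ⇒
zero-free upgrade, no Gram/Rosser law, no Turing method; zeros enter with multiplicity at any real
part above T (|Re[1 − (1−1/ρ)ⁿ] − f_n| two-sided bound, K1χ).
- Literature.Barriers.RiemannHypothesis.NymanBeurlingObstructions / MollifierLimitat

History (route lifecycle, newest last):
- 2026-08-26T14:15:25Z · CLOSED proved — proved:Summit.RiemannHypothesis.RiemannHypothesis.Theorems.LiTheory.liDirichletAsymptoticLaw_proof (operator:999:1494936)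

sub-problem: RiemannHypothesis · status: closed(proved) · opened planner-rh-li-theory-g7-0 2026-08-26T07:46:49Z · rev 2 · ledger route-RiemannHypothesis-LiDirichletAsymptotic
GENERATED by the gate from the ledger (D-0016/17). Provers cite these decls: `theorem foo : Summit.RiemannHypothesis.RiemannHypothesis.Theses.LiDirichletAsymptotic.<Decl> := …` in Summits/RiemannHypothesis/RiemannHypothesis/Theorems/<Name>.lean.
-/

namespace Summit.RiemannHypothesis.RiemannHypothesis.Theses.LiDirichletAsymptotic

open scoped BigOperators Topology Manifold Classical MeasureTheory ProbabilityTheory Matrix InnerProductSpace ComplexConjugate ContinuousMap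
open Filter Set Function TopologicalSpace MeasureTheory

attribute [summit_statement] _root_.Summit.RiemannHypothesis
attribute [summit_statement] _root_.Summit.RiemannHypothesis.RiemannHypothesis.Theorems.LiTheory.LiDirichletAsymptoticLaw

open Summit

/-- item stmt-RiemannHypothesis-19628 · crux · rank 2 · closed · proved by Summit.RiemannHypothesis.RiemannHypothesis.Theorems.LiTheory.liOscillatoryChar_proof (prover) · by planner
why it might fail: the remainder bound holds only off ordinates (`abs_lfunctionZeroCount_sub_le`) inside a Stieltjes IBP over a step function (one-sided limits); the constants 46.8 / 0.42 bounding ∫(n/t²)·rem are certified only through K4χ's budget, not term by term; log(1+ℓ(T')) unbounded ⇒ explicit top term.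
sources: MontgomeryVaughan2007, BennettMartinOBryantRechnitzer2021, Lagarias2007LiCoefficients, tree:Literature/NumberTheory/LFunctions/DirichletArgSBound.lean, tree:Literature/NumberTheory/LFunctions/DirichletLZeroCountExplicit.lean
[crux] (K3χ, deciding) OSCILLATORY CONTROL, RH-free: the window sum `Σ_{√n<|γ|≤T'} m f_n(|γ|)` minus
its smooth part `(2/π)∫_{√n}^{T'} f_n g_χ` is at most `charErrOscP q n` (tree constants, n ≥ 10⁴)
resp., given BMOR Thm 1.1, `charErrOscB q n` (n ≥ 900), plus the TOP boundary term
`(n²/(2T'²))·rem(q,T')` which vanishes as T' → ∞ (q-uniformity forces it out of the constant):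
window identity against the two-sided count N(t,χ) = exact main + remainder, ONE integration by
parts (|f_n'| ≤ n/t², f_n ≤ 2, f_n(t) ≤ n²/(2t²)). [difficulty: L] -/
@[route_item "route-RiemannHypothesis-LiDirichletAsymptotic", crux]
def LiOscillatoryChar : Prop :=
  ∀ (q : ℕ) [NeZero q] (χ : DirichletCharacter ℂ q), χ.IsPrimitive → 1 < q → ∀ (n : ℕ) (T' : ℝ), (n : ℝ) ^ 2 ≤ T' → (10000 ≤ n → |(Summit.RiemannHypothesis.RiemannHypothesis.Theorems.LiTheory.charWeightTrace χ n T' - Summit.RiemannHypothesis.RiemannHypothesis.Theorems.LiTheory.charWeightTrace χ n (Real.sqrt n)) - 2 / Real.pi * (∫ t in Real.sqrt n..T', Summit.RiemannHypothesis.RiemannHypothesis.Theorems.LiTheory.liWindowWeight n t * Summit.RiemannHypothesis.RiemannHypothesis.Theorems.LiTheory.charGammaDensity χ t)| ≤ Summit.RiemannHypothesis.RiemannHypothesis.Theorems.LiTheory.charErrOscP q n + (n : ℝ) ^ 2 / (2 * T' ^ 2) * Summit.RiemannHypothesis.RiemannHypothesis.Theorems.LiTheory.argSRem q T') ∧ (Literature.NumberTheory.LFunctions.bmor2021_theorem11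 → 900 ≤ n → |(Summit.RiemannHypothesis.RiemannHypothesis.Theorems.LiTheory.charWeightTrace χ n T' - Summit.RiemannHypothesis.RiemannHypothesis.Theorems.LiTheory.charWeightTrace χ n (Real.sqrt n)) - 2 / Real.pi * (∫ t in Real.sqrt n..T', Summit.RiemannHypothesis.RiemannHypothesis.Theorems.LiTheory.liWindowWeight n t * Summit.RiemannHypothesis.RiemannHypothesis.Theorems.LiTheory.charGammaDensity χ t)| ≤ Summit.RiemannHypothesis.RiemannHypothesis.Theorems.LiTheory.charErrOscB q n + (n : ℝ) ^ 2 / (2 * T' ^ 2) * Summit.RiemannHypothesis.RiemannHypothesis.Theorems.LiTheory.bmorRem q T')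

-- `LiOscillatoryChar` holds: proved by `Summit.RiemannHypothesis.RiemannHypothesis.Theorems.LiTheory.liOscillatoryChar_proof` (its module imports this route file, so no `_holds` link can be stated here).

/-- item stmt-RiemannHypothesis-19629 · crux · rank 3 · closed · proved by Summit.RiemannHypothesis.RiemannHypothesis.Theorems.LiTheory.liBoxTwoSidedChar_proof (prover) · by planner
why it might fail: the χ-pair {ρ, 1−ρ̄} shares the ordinate, so the comparison angle lemma is the ζ one, but the multiplicity identity zeroOrder χ (1 − conj ρ) = zeroOrder χ ρ must come from the tree's reflection for dirichletXi (odd χ: normalisation q^{(s+a)/2}); n ≤ T²/4 is where (1 − 1/ρ)ⁿ stays bounded for |γ| …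
sources: Lagarias2007LiCoefficients, BombieriLagarias1999, MontgomeryVaughan2007, tree:Literature/NumberTheory/LFunctions/DirichletLFunctionZeroReflection.lean, tree:Literature/NumberTheory/LFunctions/ExplicitFormulaPsiCharZeros.lean (zeroOrder_one_sub_eq_inv), tree:Literature/NumberTheory/LFunctions/DirichletXiConjugation.lean
[crux] (K1χ) TWO-SIDED BOX COMPARISON: below the verified height every zero is on the line and
contributes `m f_n(|γ|)` EXACTLY to `Re Σ m[1 − (1 − 1/ρ)ⁿ]`; above it the zeros pair as `{ρ, 1 −
ρ̄}` (functional equation + reflection, same multiplicity) and the pair is compared with `2 f_n(γ)`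
two-sidedly: `2(cosh(n log r) − 1) + 2n|φ − θ(γ)|` per pair, giving the per-zero constants `2.82
n²/γ⁴` and `(n/2)/|γ|³` of the ζ twin LiBoxTwoSided (19163, CLOSED) with a factor 2 to spare.
[difficulty: M] -/
@[route_item "route-RiemannHypothesis-LiDirichletAsymptotic", crux]
def LiBoxTwoSidedChar : Prop :=
  ∀ (q : ℕ) [NeZero q] (χ : DirichletCharacter ℂ q), χ.IsPrimitive → 1 < q → ∀ (n : ℕ) (T T' : ℝ), Literature.NumberTheory.LFunctions.LFunctionRHUpTo χ T → 4 ≤ T → T ≤ T' → (n : ℝ) ≤ T ^ 2 / 4 → |Summit.RiemannHypothesis.RiemannHypothesis.Theorems.LiTheory.charLiPartialRe χ n T' - Summit.RiemannHypothesis.RiemannHypothesis.Theorems.LiTheory.charWeightTrace χ n T'| ≤ 2.82 * (n : ℝ) ^ 2 * Summit.RiemannHypothesis.RiemannHypothesis.Theorems.LiTheory.charInvMomentTail χ 4 T T' + (n : ℝ) / 2 * Summit.RiemannHypothesis.RiemannHypothesis.Theorems.LiTheory.charInvMomentTail χ 3 T T'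

-- `LiBoxTwoSidedChar` holds: proved by `Summit.RiemannHypothesis.RiemannHypothesis.Theorems.LiTheory.liBoxTwoSidedChar_proof` (its module imports this route file, so no `_holds` link can be stated here).

/-- item stmt-RiemannHypothesis-19630 · crux · rank 4 · closed · proved by Summit.RiemannHypothesis.RiemannHypothesis.Theorems.LiTheory.liSmoothMainTermChar_proof (prover) · by planner
why it might fail: charErrSmooth's «2 log q + 3» is derived but generous; the exact boundary term needs d/dt charCountMainExact = (2/π)·charGammaDensity as an FTC statement for gammaArgPhase (the Γ_ℝ(s+κ) ↔ ψ((½+a+it)/2) half-scaling is a factor-2 trap), plus |½Re ψ − ½log(t/2)| ≤ 1/t² from DigammaGauss.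
sources: Lagarias2007LiCoefficients, MontgomeryVaughan2007, tree:Literature/Analysis/SpecialFunctions/DigammaGauss.lean, tree:Summits/RiemannHypothesis/RiemannHypothesis/Theorems/LiAsymptoticLiSmoothMainTerm.lean, tree:Literature/NumberTheory/LFunctions/DirichletLZeroCountingParityProfile.lean
[crux] (K2χ) SMOOTH MAIN TERM: `(2/π)∫_{√n}^{T'} f_n(t) g_χ(t) dt = charLiMainTerm q n −
charCountMainExact χ √n ± charErrSmooth q n` (= 2 log n + 2 log q + 3) for T' ≥ n², n ≥ 100 — the ζ
computation (19162, CLOSED: exact model identity (2/π)∫₀^∞(1−cos(n/t))·½log(t/2π) = liMainTerm n,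
corrections θ vs 1/t and the two cuts) with ϑ' replaced by g_χ = ½Re ψ((½+a+it)/2) + ½log(q/π): the
conductor adds (log q/π)∫f_n = (n/2)log q − (√n/π)log q + O(log q), the √n-term being the q-part of
the EXACT boundary main term charCountMainExact (whose derivative is (2/π)g_χ), and |½Re ψ − ½
log(t/2)| ≤ 1/t² (tree DigammaGauss.abs_re_digamma_sub_log_norm_le) costs O(1/√n). [difficulty: M] -/
@[route_item "route-RiemannHypothesis-LiDirichletAsymptotic", crux]
def LiSmoothMainTermChar : Prop :=
  ∀ (q : ℕ) [NeZero q] (χ : DirichletCharacter ℂ q), χ.IsPrimitive → 1 < q → ∀ (n : ℕ) (T' : ℝ), 100 ≤ n → (n : ℝ) ^ 2 ≤ T' → |2 / Real.pi * (∫ t in Real.sqrt n..T', Summit.RiemannHypothesis.RiemannHypothesis.Theorems.LiTheory.liWindowWeight n t * Summit.RiemannHypothesis.RiemannHypothesis.Theorems.LiTheory.charGammaDensity χ t) - (Summit.RiemannHypothesis.RiemannHypothesis.Theorems.LiTheory.charLiMainTerm q n - Summit.RiemannHypothesis.RiemannHypothesis.Theorems.LiTheory.charCountMainExact χ (Real.sqrt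 n))| ≤ Summit.RiemannHypothesis.RiemannHypothesis.Theorems.LiTheory.charErrSmooth q n

-- `LiSmoothMainTermChar` holds: proved by `Summit.RiemannHypothesis.RiemannHypothesis.Theorems.LiTheory.liSmoothMainTermChar_proof` (its module imports this route file, so no `_holds` link can be stated here).

/-- item stmt-RiemannHypothesis-19631 · crux · rank 5 · closed · proved by Summit.RiemannHypothesis.RiemannHypothesis.Theorems.LiTheory.liBudgetChar_proof (prover) · by planner
why it might fail: three-variable inequality (q,n,T); interval-certified in-seat (et_r5b_interval.py: plain ≤ 0.929, BMOR ≤ 0.864 on n ≤ 10⁴⁰, exact affine-in-log q sup; tail by a termwise majorant the Lean proof must re-derive) — a Lean proof over three variables is still real work; plain margin → 0.886.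
sources: folder:r5_budget_check.py, Lagarias2007LiCoefficients, BennettMartinOBryantRechnitzer2021
[crux] (K4χ) ERROR BUDGET: a closed-form real inequality in (q, n, T), uniform in q ≥ 2: far + low +
smooth + oscillatory ≤ 15 √n log(qn) (n ≥ 10⁴, tree constants) resp. ≤ √n log(qn) (n ≥ 900, BMOR
constants); in-seat float sup of budget/bound = 0.908 (q → ∞ limit 12.975/15) resp. 0.827 (at q =
3000, n = 900, T = 1000). [difficulty: S] -/
@[route_item "route-RiemannHypothesis-LiDirichletAsymptotic", crux]
def LiBudgetChar : Prop :=
  ∀ (q : ℕ), 2 ≤ q → ∀ (n : ℕ) (T : ℝ), 1000 ≤ T → (n : ℝ) ≤ 1 / 4 * T ^ 2 → (10000 ≤ n → Summit.RiemannHypothesis.RiemannHypothesis.Theorems.LiTheory.charErrFar q n T + Summit.RiemannHypothesis.RiemannHypothesis.Theorems.LiTheory.charErrLowP q n + Summit.RiemannHypothesis.RiemannHypothesis.Theorems.LiTheory.charErrSmooth q n + Summit.RiemannHypothesis.RiemannHypothesis.Theorems.LiTheory.charErrOscP q n ≤ 15 * Real.sqrt n * Real.log (q * n)) ∧ (900 ≤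 n → Summit.RiemannHypothesis.RiemannHypothesis.Theorems.LiTheory.charErrFar q n T + Summit.RiemannHypothesis.RiemannHypothesis.Theorems.LiTheory.charErrLowB q n + Summit.RiemannHypothesis.RiemannHypothesis.Theorems.LiTheory.charErrSmooth q n + Summit.RiemannHypothesis.RiemannHypothesis.Theorems.LiTheory.charErrOscB q n ≤ Real.sqrt n * Real.log (q * n))

-- `LiBudgetChar` holds: proved by `Summit.RiemannHypothesis.RiemannHypothesis.Theorems.LiTheory.liBudgetChar_proof` (its module imports this route file, so no `_holds` link can be stated here).

/-- item stmt-RiemannHypothesis-19562 · aside · rank 9 · closed · moot by None · by planner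
why it might fail: n/a — a published theorem (BMOR 2021 Thm 1.1); declared, not attacked; formalising it is XL and outside this route
sources: BennettMartinOBryantRechnitzer2021
[aside] BMOR 2021 Thm 1.1 (Bennett–Martin–O'Bryant–Rechnitzer, explicit two-sided N(T,χ) bound;
published, unproved in tree — named fact `bmor2021_theorem11`); hypothesis of the sharp (C,n₀) =
(1,900) conjuncts of 19628 LiOscillatoryChar, 19633 LiLowZerosChar and of the leaf
LiDirichletAsymptoticLaw; declared by name so the route names its published-unproved input
(obligation-graph rule; auto-HELD, never served). Source: BennettMartinOBryantRechnitzer2021 Thm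
1.1. -/
@[route_item "route-RiemannHypothesis-LiDirichletAsymptotic"]
def Bmor2021Theorem11 : Prop :=
  Literature.NumberTheory.LFunctions.bmor2021_theorem11

/-- item stmt-RiemannHypothesis-19632 · support · rank 9 · closed · proved by Summit.RiemannHypothesis.RiemannHypothesis.Theorems.LiTheory.liFarTailsChar_proof (prover) · by planner
sources: MontgomeryVaughan2007, tree:Summits/RiemannHypothesis/RiemannHypothesis/Theorems/LiAsymptoticLiFarZeroTailCube.lean
[support] [support] (S2χ) RH-FREE FAR TAILS: `Σ_{T<|γ|≤U} m/|γ|³ ≤ log(qT)/(πT²)` and `Σ m/γ⁴ ≤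
log(qT)/(2πT³)` for T ≥ 1000, by Stieltjes integration of t^{−k} against the two-sided count (main
(1/(2πT²))(log(qT/2πe) + 3/2), resp. (1/(3πT³))(log(qT/2πe) + 4/3), plus 2·argSRem/T^k) — the χ twin
of LiFarZeroTailCube (19229, CLOSED). [difficulty: M] -/
@[route_item "route-RiemannHypothesis-LiDirichletAsymptotic", crux]
def LiFarTailsChar : Prop :=
  ∀ (q : ℕ) [NeZero q] (χ : DirichletCharacter ℂ q), χ.IsPrimitive → 1 < q → ∀ (T U : ℝ), 1000 ≤ T → T ≤ U → Summit.RiemannHypothesis.RiemannHypothesis.Theorems.LiTheory.charInvMomentTail χ 3 T U ≤ Real.log (q * T) / (Real.pi * T ^ 2) ∧ Summit.RiemannHypothesis.RiemannHypothesis.Theorems.LiTheory.charInvMomentTail χ 4 T U ≤ Real.log (q * T) / (2 * Real.pi * T ^ 3)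

-- `LiFarTailsChar` holds: proved by `Summit.RiemannHypothesis.RiemannHypothesis.Theorems.LiTheory.liFarTailsChar_proof` (its module imports this route file, so no `_holds` link can be stated here).

/-- item stmt-RiemannHypothesis-19633 · support · rank 9 · closed · proved by Summit.RiemannHypothesis.RiemannHypothesis.Theorems.LiTheory.liLowZerosChar_proof (prover) · by planner
sources: MontgomeryVaughan2007, tree:Literature/NumberTheory/LFunctions/DirichletArgSBound.lean, tree:Literature/NumberTheory/LFunctions/DirichletLZeroCountingParityProfile.lean
[support] [support] (S1χ) LOW ZEROS TRIVIALLY (RH-free): `0 ≤ Σ_{|γ|≤√n} m f_n ≤ 2N(√n,χ)` and the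
two-sided count give `|Σ − M_exact(√n)| ≤ M_exact(√n) + 2·rem(√n)`, with the one-sided Stirling step
`charCountMainExact χ a ≤ charCountMain q a + 1` (θ_κ(a) ≤ (a/2)log(a/2πe) + ½, classical).
[difficulty: M] -/
@[route_item "route-RiemannHypothesis-LiDirichletAsymptotic", crux]
def LiLowZerosChar : Prop :=
  ∀ (q : ℕ) [NeZero q] (χ : DirichletCharacter ℂ q), χ.IsPrimitive → 1 < q → ∀ (n : ℕ), 900 ≤ n → |Summit.RiemannHypothesis.RiemannHypothesis.Theorems.LiTheory.charWeightTrace χ n (Real.sqrt n) - Summit.RiemannHypothesis.RiemannHypothesis.Theorems.LiTheory.charCountMainExact χ (Real.sqrt n)| ≤ Summit.RiemannHypothesis.RiemannHypothesis.Theorems.LiTheory.charErrLowP q n ∧ (Literature.NumberTheory.LFunctions.bmor2021_theorem11 → |Summit.RiemannHypothesis.RiemannHypothesis.Theorems.LiTheory.charWeightTrace χ n (Real.sqrt n) - Summit.RiemannHypothesis.RiemannHypothesis.Theorems.LiTheory.charCountMainExact χ (Real.sqrt n)| ≤ Summit.RiemannHypothesis.RiemannHypothesis.Theorems.LiTheory.charErrLowB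 q n)

-- `LiLowZerosChar` holds: proved by `Summit.RiemannHypothesis.RiemannHypothesis.Theorems.LiTheory.liLowZerosChar_proof` (its module imports this route file, so no `_holds` link can be stated here).

/-- item stmt-RiemannHypothesis-19634 · assembly · rank 1 · closed · proved by Summit.RiemannHypothesis.RiemannHypothesis.Theorems.LiTheory.liDirichletAsymptotic_assembly_proof (prover) · by planner
sources: Lagarias2007LiCoefficients, tree:Summits/RiemannHypothesis/RiemannHypothesis/Theorems/LiAsymptoticAssembly.lean
[assembly] LiBoxTwoSidedChar → LiSmoothMainTermChar → LiOscillatoryChar → LiBudgetChar →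
LiLowZerosChar → LiFarTailsChar → the rung leaf LiDirichletAsymptoticLaw (the ζ assembly 19166
transposed; size M). -/
@[route_item "route-RiemannHypothesis-LiDirichletAsymptotic", crux]
def Assembly : Prop :=
  Summit.RiemannHypothesis.RiemannHypothesis.Theses.LiDirichletAsymptotic.LiBoxTwoSidedChar → Summit.RiemannHypothesis.RiemannHypothesis.Theses.LiDirichletAsymptotic.LiSmoothMainTermChar → Summit.RiemannHypothesis.RiemannHypothesis.Theses.LiDirichletAsymptotic.LiOscillatoryChar → Summit.RiemannHypothesis.RiemannHypothesis.Theses.LiDirichletAsymptotic.LiBudgetChar → Summit.RiemannHypothesis.RiemannHypothesis.Theses.LiDirichletAsymptotic.LiLowZerosChar → Summit.RiemannHypothesis.RiemannHypothesis.Theses.LiDirichletAsymptotic.LiFarTailsChar → Summit.RiemannHypothesis.RiemannHypothesis.Theorems.LiTheory.LiDirichletAsymptoticLaw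

-- `Assembly` holds: proved by `Summit.RiemannHypothesis.RiemannHypothesis.Theorems.LiTheory.liDirichletAsymptotic_assembly_proof` (its module imports this route file, so no `_holds` link can be stated here).

/-! D-0027 §2.1 — DECIDING THEOREM (planner-authored via `route open/edit --closes-file`; by planner-rh-li-theory-g7-0 2026-08-26T07:46:49Z) — ARCHIVED: route closed (proved) 2026-08-26T14:15:24Z; kept so importers keep building:
its hypotheses are this route's items and its conclusion the registered leaf `Summit.RiemannHypothesis.RiemannHypothesis.Theorems.LiTheory.LiDirichletAsymptoticLaw` (rung L-P(P1+chi), D-0061) (glue_lint), and it elaborates with this file. -/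

-- glue.lean — DECIDING THEOREM of route LiDirichletAsymptotic (D-0027 §2.1; R5 shape, D-0061: concludes the RUNG LEAF
-- `Summit.RiemannHypothesis.RiemannHypothesis.Theorems.LiTheory.LiDirichletAsymptoticLaw` («Dirichlet Li asymptotic law,
-- quadratic range, uniform in q», RH/GRH-FREE) BY NAME).  Hypotheses = the four crux decls + the two RH-free supports +
-- the Assembly item (the ζ assembly 19166 transposed); every binder is consumed (BC1: 7 binders, 4 open cruxes + 2
-- supports + assembly; BC6 clean).
@[closes "route-RiemannHypothesis-LiDirichletAsymptotic"] theorem closes (h1 : LiBoxTwoSidedChar) (h2 : LiSmoothMainTermChar) (h3 : LiOscillatoryChar) (h4 : LiBudgetChar)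
    (h5 : LiLowZerosChar) (h6 : LiFarTailsChar) (hA : Assembly) :
    Summit.RiemannHypothesis.RiemannHypothesis.Theorems.LiTheory.LiDirichletAsymptoticLaw :=
  hA h1 h2 h3 h4 h5 h6

end Summit.RiemannHypothesis.RiemannHypothesis.Theses.LiDirichletAsymptotic
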